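import Summits.QuantumFields.YangMills.Theorems.LuscherReductionTwistedTraceScalingBTDiagonalPhase
import Summits.QuantumFields.YangMills.Theorems.TwistedTraceScaling.Negative.AvgKernelNoLabSlowFactor
import HarnessLib

/-!
# The diagonal integrand of `fpBOKernel(u,u)/K₁(u,u)` IS the `u = 1` integrand times `exp(diagX)` — EXACTLY
# (lane A of S-BASE, crux `TwistedTraceScaling` stmt-QuantumFields-20203, C4-CORE, the (B-T) pen (L3); design note `pub/ym-fleet/ym-luscher-20007-p1/COARSE-DESIGN.md` §25.7–§25.8)

The identity that connects `…BTDiagonalPhase`/`…BTDiagonalAverage` (pointwise statements about `diagX`) with the kernel `fpBOKernel` of `…BTColourFP`: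
* `transferKernel_constLift_self` — `K_β(constLift u, constLift u) = exp(β(2|E| − L³S₁(u)))` (`timeCoupling_self`, `wilsonAction_constLift`);
* ★★ `transferKernel_orthoTube_diag_div` — for every `u, v, v', g`:
  `K_β(orthoTube u v, g·orthoTube u v') / K_β(constLift u, constLift u) = [K_β(orthoTube 1 v, g·orthoTube 1 v') / K_β(constLift 1, constLift 1)] · exp(diagX β u v v' g)`;
* ★ `transferKernel_constLift_self_eq_one_site` — `K_β(constLift u, constLift u) = K₁^{(L³β)}(u,u)` (`transferKernel_constLift`), so the left side is the integrand of `fpBOKernel(u,u)/K₁^{(L³β)}(u,u)`.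
Hence `f(u) := fpBOKernel β Ω W u u / K₁^{(L³β)}(u,u) = ∫∫∫ Ω(v)W(g)Ω(v')·ρ₁(v,v',g)·exp(diagX β u v v' g)` with `ρ₁` the `u = 1` ratio — the form in which `haar_integral_exp_diagX_sandwich` applies after
`f(u) = ∫_d f(dud⁻¹) dd` (`fpBOKernel_conj`) and one Fubini (successor: `…BTDiagonalIntegral`).
HONEST FRAMING: exact algebra for a stub of a child of the CONDITIONAL reduction route R2b1; the Laplace core of (B-T) is OPEN; C4-CORE OPEN; not infinite volume, not a gap, not Clay.
-/

set_option autoImplicit false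

noncomputable section

open MeasureTheory Filter Topology Real
open scoped BigOperators
open Literature.MathematicalPhysics.QuantumFieldTheory
open Literature.MathematicalPhysics.QuantumLattice

namespace Summit.QuantumFields.YangMills.Theorems.FemtoTransferGap.TwoLattice.ConstTube

open Summit.QuantumFields.YangMills.Theorems.FemtoTransferGap
open Summit.QuantumFields.YangMills.Theorems.FemtoTransferGap.TwoLattice
open Summit.QuantumFields.YangMills.Theorems.FemtoTransferGap.TwoLattice.Toron (wilsonAction_constLift_eq)
open Summit.QuantumFields.YangMills.Theorems.TwistedTraceScaling.Negative.R32 (timeCoupling_self)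

variable {L : ℕ} [NeZero L]

/-- `K_β(constLift u, constLift u) = exp(β(2|E| − L³S₁(u)))`. [folklore] -/
theorem transferKernel_constLift_self (β : ℝ) (u : GaugeConfig 3 1 SU2) :
    transferKernel su2Rep β (constLift L u) (constLift L u) = Real.exp (β * (2 * (Fintype.card (Edge 3 L) : ℝ)) - β * ((L : ℝ) ^ 3 * wilsonAction su2Rep u)) := by
  unfold transferKernel
  rw [timeCoupling_self, wilsonAction_constLift_eq]
  congr 1; ring

/-- `K_β(constLift u, constLift u) = K₁^{(L³β)}(u, u)`. [cite: Luscher1983, §3] -/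
theorem transferKernel_constLift_self_eq_one_site (β : ℝ) (u : GaugeConfig 3 1 SU2) :
    transferKernel su2Rep β (constLift L u) (constLift L u) = transferKernel su2Rep ((L : ℝ) ^ 3 * β) u u :=
  transferKernel_constLift su2Rep L β u u

/-- ★★ **The diagonal integrand factorises through `u = 1`**: `K(oT u v, g·oT u v')/K(cL u, cL u) = [K(oT 1 v, g·oT 1 v')/K(cL 1, cL 1)]·exp(diagX β u v v' g)`. [cite: Luscher1983, §3] -/
theorem transferKernel_orthoTube_diag_div (β : ℝ) (u : GaugeConfig 3 1 SU2) (v v' : Edge 3 L → Fin 3 → ℝ) (g : Site 3 L → SU2) :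
    transferKernel su2Rep β (orthoTube L u v) (gaugeTransform g (orthoTube L u v')) / transferKernel su2Rep β (constLift L u) (constLift L u) =
      transferKernel su2Rep β (orthoTube L 1 v) (gaugeTransform g (orthoTube L 1 v')) / transferKernel su2Rep β (constLift L 1) (constLift L 1) *
        Real.exp (diagX L β u v v' g) := by
  rw [transferKernel_constLift_self, transferKernel_constLift_self, wilsonAction_one_eq_zero, mul_zero, mul_zero, sub_zero]
  unfold transferKernel diagX
  rw [wilsonAction_gaugeTransform, wilsonAction_gaugeTransform, ← Real.exp_sub, ← Real.exp_sub, ← Real.exp_add]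
  congr 1
  ring

/-- The same with the one-site kernel in the denominator: `K(oT u v, g·oT u v')/K₁^{(L³β)}(u,u) = [K(oT 1 v, g·oT 1 v')/K₁^{(L³β)}(1,1)]·exp(diagX β u v v' g)`. [cite: Luscher1983, §3] -/
theorem transferKernel_orthoTube_diag_div_one_site (β : ℝ) (u : GaugeConfig 3 1 SU2) (v v' : Edge 3 L → Fin 3 → ℝ) (g : Site 3 L → SU2) :
    transferKernel su2Rep β (orthoTube L u v) (gaugeTransform g (orthoTube L u v')) / transferKernel su2Rep ((L : ℝ) ^ 3 * β) u u =
      transferKernel su2Rep β (orthoTube L 1 v) (gaugeTransform g (orthoTube L 1 v')) / transferKernel su2Rep ((L : ℝ) ^ 3 * β) (1 : GaugeConfig 3 1 SU2) 1 *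
        Real.exp (diagX L β u v v' g) := by
  rw [← transferKernel_constLift_self_eq_one_site, ← transferKernel_constLift_self_eq_one_site (L := L) β 1, constLift_one']
  have h := transferKernel_orthoTube_diag_div (L := L) β u v v' g
  rw [constLift_one'] at h
  exact h

end Summit.QuantumFields.YangMills.Theorems.FemtoTransferGap.TwoLattice.ConstTube

end
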